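import Mathlib
import HarnessLib
import Literature.Computability.AlgebraicComplexity.AsymptoticSpectrum
import Literature.Computability.AlgebraicComplexity.BorderRankCW
import Literature.Computability.AlgebraicComplexity.BILPS19MinrankVarieties
import Literature.Computability.AlgebraicComplexity.BILPS19MinrankInvarianceProofs
import Literature.Computability.AlgebraicComplexity.DegenerationSpectralMonotone
import Summits.MatrixMultiplication.MatrixMultiplication.Theorems.OutsiderSandwichPolystableRigidity
import Summits.MatrixMultiplication.MatrixMultiplication.Theorems.OutsiderSandwichCwTwoPowPolystable
import Summits.MatrixMultiplication.MatrixMultiplication.Theorems.OutsiderSandwichUnitKroneckerRigidity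
import Summits.MatrixMultiplication.MatrixMultiplication.Theorems.OutsiderSandwichMinrankGap
import Summits.MatrixMultiplication.MatrixMultiplication.Theorems.OutsiderSandwichRestrictionGap
import Summits.MatrixMultiplication.MatrixMultiplication.Theorems.OutsiderSandwichDegenerationBridge

/-!
# OutsiderSandwich — exact minranks `minrank(⟨n⟩ ⊠ cw₂^{⊠N}) = 2^N`, `minrank(⟨n'⟩ ⊠ ⟨m,m,m⟩) = m`, and the
forward transport of `𝓜_r` (lens-4 g33, K33-E part 1; completes `OutsiderSandwichMinrankGap`; the two-sided
gap theorems are in `OutsiderSandwichTwoSidedGap`)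

Route-independent support kernel (no `Theses` import, no new definitions).

`OutsiderSandwichMinrankGap` used one half of the minrank invariant (BILPS Def. 13):
`minrank(⟨n⟩ ⊠ cw₂^{⊠N}) ≥ 2^N` and `minrank(⟨n'⟩ ⊠ ⟨m,m,m⟩) ≤ m`.  Here both values are computed EXACTLY,

* `minrank_unitKronecker_cwTwoPow` : `minrank(⟨n⟩ ⊠ cw₂^{⊠N}) = 2^N` (`n ≥ 1`; the coordinate slice at the
  word `0^N` is diagonal with `2^N` ones — more generally `⟨n⟩ ⊠ cw_q^{⊠N} ∈ 𝓜_{q^N}`),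
* `minrank_unitKronecker_matMul` : `minrank(⟨n'⟩ ⊠ ⟨m,m,m⟩) = m` (every non-zero slice contains an
  `m × m` scalar block),

and `𝓜_r` is transported FORWARD along `w ↦ c • (s₁ ⊗ s₂ ⊗ s₃)·w` (`smul_actTensor_mem_minrankSet`, BILPS
Lemma 18 with scalars; the backward transport is `OutsiderSandwichMinrankGap.mem_minrankSet_of_eq_smul_actTensor`),
so that the Kempf–Ness isomorphism of `exists_smul_sl3_eq_of_degeneratesTo` can be used in both directions
(`OutsiderSandwichTwoSidedGap`: a degeneration in either direction forces `m = 2^N`).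

Honest tag: `ω`-free negative calibration; the reach of the minrank invariant is now exactly known — it is
silent precisely on the slope-one line `m = 2^N` (e.g. `⟨4⟩ ⊠ cw₂` vs `⟨3⟩ ⊠ ⟨2,2,2⟩`), and says nothing
asymptotically.

References: [cite: BlaserIkenmeyerLysikovPandeySchreyer2019, Def. 13, Def. 15, Lemma 18];
[cite: KempfNess1979, Thm. 0.2]; [cite: BurgisserClausenShokrollahi1997, (15.19)];
[cite: CoppersmithWinograd1990, §6]; [cite: Blaser2013, §5].
-/

noncomputable section

open scoped BigOperators Matrix

open Literature.Computability.AlgebraicComplexity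
open Literature.Barriers.MatrixMultiplication

namespace Summit.MatrixMultiplication.MatrixMultiplication.Theorems.OutsiderSandwichMinrankExact

open OutsiderSandwichPolystableRigidity OutsiderSandwichCwTwoPowPolystable
  OutsiderSandwichUnitKroneckerRigidity OutsiderSandwichMinrankGap OutsiderSandwichRestrictionGap
  OutsiderSandwichDegenerationBridge

/-! ## §1  The matrix-multiplication side: `minrank(⟨n'⟩ ⊠ ⟨m,m,m⟩) = m` -/

section MatMulSide

/-- **Every non-zero slice of `⟨n'⟩ ⊠ ⟨m,m,m⟩` has rank `≥ m`**: if `x_{(u₀,(i₀,j₀))} ≠ 0`, the rows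
`(u₀,(i₀,μ))` and columns `(u₀,(μ',j₀))` carry the block `x_{(u₀,(i₀,j₀))} · 1_m`. [cite: Blaser2013, §5] -/
theorem le_rank_contract3_unitKronecker_matMul {n' m : ℕ} {x : Fin n' × (Fin m × Fin m) → ℂ}
    (hx : x ≠ 0) :
    m ≤ (contract3 (kroneckerTensor (unitTensor ℂ n') (matMulTensor ℂ m m m)) x).rank := by
  classical
  obtain ⟨⟨u₀, i₀, j₀⟩, hx₀⟩ : ∃ a, x a ≠ 0 := by
    by_contra h
    push Not at h
    exact hx (funext h)
  set M := contract3 (kroneckerTensor (unitTensor ℂ n') (matMulTensor ℂ m m m)) x with hM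
  have hsub : M.submatrix (fun μ : Fin m => (u₀, (i₀, μ))) (fun μ' : Fin m => (u₀, (μ', j₀))) =
      x (u₀, (i₀, j₀)) • (1 : Matrix (Fin m) (Fin m) ℂ) := by
    ext μ μ'
    simp only [hM, Matrix.submatrix_apply, contract3_apply, Matrix.smul_apply, Matrix.one_apply,
      smul_eq_mul]
    rw [Finset.sum_eq_single (u₀, (i₀, j₀)) ?_ (by simp)]
    · simp [matMulTensor]
    · rintro ⟨u, i, j⟩ _ hne
      by_cases hu : u = u₀
      · by_cases hi : i = i₀
        · have hj : j ≠ j₀ := fun hj => hne (by rw [hu, hi, hj])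
          simp [matMulTensor, hj]
        · simp [matMulTensor, hi]
      · simp [hu]
  have hrank1 : (x (u₀, (i₀, j₀)) • (1 : Matrix (Fin m) (Fin m) ℂ)).rank = m := by
    rw [Matrix.rank_of_isUnit, Fintype.card_fin]
    rw [Matrix.isUnit_iff_isUnit_det, Matrix.det_smul, Matrix.det_one, mul_one]
    exact isUnit_iff_ne_zero.mpr (pow_ne_zero _ hx₀)
  calc m = (x (u₀, (i₀, j₀)) • (1 : Matrix (Fin m) (Fin m) ℂ)).rank := hrank1.symm
    _ = (M.submatrix (fun μ : Fin m => (u₀, (i₀, μ))) (fun μ' : Fin m => (u₀, (μ', j₀)))).rank := by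
          rw [hsub]
    _ ≤ M.rank := Matrix.rank_submatrix_le _ _ _

/-- `e^*(⟨n'⟩ ⊠ ⟨m,m,m⟩) ∉ 𝓜_r` for `r < m`, for every relabelling `e`. [cite: BlaserIkenmeyerLysikovPandeySchreyer2019, Def. 15] -/
theorem not_mem_minrankSet_relabel_unitKronecker_matMul {ι' : Type} [Fintype ι'] [DecidableEq ι']
    {n' m r : ℕ} (hr : r < m) (e : ι' ≃ (Fin n' × (Fin m × Fin m))) :
    (fun a b c => kroneckerTensor (unitTensor ℂ n') (matMulTensor ℂ m m m) (e a) (e b) (e c)) ∉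
      (minrankSet ℂ r : Set (ι' → ι' → ι' → ℂ)) := by
  classical
  rintro ⟨y, hy, hrank⟩
  set x : Fin n' × (Fin m × Fin m) → ℂ := fun a => y (e.symm a) with hx
  have hyx : y = fun a => x (e a) := by
    funext a
    simp [hx]
  have hx0 : x ≠ 0 := by
    intro h0
    apply hy
    funext a
    have := congr_fun h0 (e a)
    simpa [hx] using this
  rw [hyx, contract3_relabel, Matrix.rank_submatrix] at hrank
  exact absurd ((le_rank_contract3_unitKronecker_matMul hx0).trans hrank) (not_le.mpr hr)

/-- **`minrank(⟨n'⟩ ⊠ ⟨m,m,m⟩) = m`** (`n', m ≥ 1`). [cite: BlaserIkenmeyerLysikovPandeySchreyer2019, Def. 13]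
[cite: Blaser2013, §5] -/
theorem minrank_unitKronecker_matMul {n' m : ℕ} (hn' : 0 < n') (hm : 0 < m) :
    minrank (kroneckerTensor (unitTensor ℂ n') (matMulTensor ℂ m m m)) = m := by
  classical
  set p₀ : Fin n' × (Fin m × Fin m) := (⟨0, hn'⟩, (⟨0, hm⟩, ⟨0, hm⟩)) with hp₀
  haveI : Nonempty (Fin n' × (Fin m × Fin m)) := ⟨p₀⟩
  apply le_antisymm
  · have hx : (fun a : Fin n' × (Fin m × Fin m) => if a = p₀ then (1 : ℂ) else 0) ≠ 0 := by
      intro h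
      have := congr_fun h p₀
      simp at this
    exact (minrank_le hx).trans (rank_contract3_unitKronecker_matMul_single_le p₀)
  · obtain ⟨x, hx, hr⟩ := (mem_minrankSet_iff_minrank_le
      (minrank (kroneckerTensor (unitTensor ℂ n') (matMulTensor ℂ m m m)))
      (kroneckerTensor (unitTensor ℂ n') (matMulTensor ℂ m m m))).2 le_rfl
    exact (le_rank_contract3_unitKronecker_matMul hx).trans hr

end MatMulSide

/-! ## §2  The Coppersmith–Winograd side: `⟨n⟩ ⊠ cw_q^{⊠N} ∈ 𝓜_{q^N}`, `minrank(⟨n⟩ ⊠ cw₂^{⊠N}) = 2^N` -/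

section CwSide

/-- The `x₀`-slice of `cw_q` is `diag(0,1,…,1)`. [cite: CoppersmithWinograd1990, §6] -/
theorem cwTensor_zero_apply (q : ℕ) (j k : Fin (q + 1)) :
    cwTensor ℂ q 0 j k = if j = k ∧ j ≠ 0 then 1 else 0 := by
  simp [cwTensor]

/-- The coordinate slice of `⟨n⟩ ⊠ cw_q^{⊠N}` at the covector `e_{(u₀, 0^N)}` is the diagonal `0/1` matrix
supported on `{(u₀, b) : b ∈ {1,…,q}^N}`. [cite: CoppersmithWinograd1990, §6] -/
theorem contract3_unitKronecker_cwPow_single {q n N : ℕ} (u₀ : Fin n) :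
    contract3 (kroneckerTensor (unitTensor ℂ n) (kroneckerPow (cwTensor ℂ q) N))
        (fun a => if a = (u₀, fun _ => (0 : Fin (q + 1))) then 1 else 0) =
      Matrix.diagonal (fun b : Fin n × (Fin N → Fin (q + 1)) =>
        if b.1 = u₀ ∧ ∀ p, b.2 p ≠ 0 then (1 : ℂ) else 0) := by
  classical
  ext b c
  simp only [contract3_apply]
  rw [Finset.sum_eq_single (u₀, fun _ => (0 : Fin (q + 1))) (fun a _ ha => by simp [ha]) (by simp)]
  simp only [if_true, one_mul, kroneckerTensor_apply, unitTensor_apply, kroneckerPow_apply,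
    cwTensor_zero_apply, Matrix.diagonal_apply]
  rw [Fintype.prod_boole]
  by_cases hbc : b = c
  · subst hbc
    rw [if_pos rfl]
    by_cases h1 : b.1 = u₀
    · by_cases h2 : ∀ p, b.2 p ≠ 0
      · simp [h1, h2]
      · simp [h1, h2]
    · simp [h1, Ne.symm h1]
  · rw [if_neg hbc]
    by_cases h1 : b.1 = c.1
    · have h2 : ¬ ∀ p, b.2 p = c.2 p ∧ b.2 p ≠ 0 :=
        fun h => hbc (Prod.ext h1 (funext fun p => (h p).1))
      simp [h2]
    · have h1' : ¬ (u₀ = b.1 ∧ b.1 = c.1) := fun h => h1 h.2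
      simp [h1']

/-- The coordinate slice at `e_{(u₀, 0^N)}` has rank `≤ q^N`. [cite: CoppersmithWinograd1990, §6] -/
theorem rank_contract3_unitKronecker_cwPow_single_le {q n N : ℕ} (u₀ : Fin n) :
    (contract3 (kroneckerTensor (unitTensor ℂ n) (kroneckerPow (cwTensor ℂ q) N))
        (fun a => if a = (u₀, fun _ => (0 : Fin (q + 1))) then 1 else 0)).rank ≤ q ^ N := by
  classical
  rw [contract3_unitKronecker_cwPow_single, Matrix.rank_diagonal]
  have hcard : Fintype.card (Fin N → {j : Fin (q + 1) // j ≠ 0}) = q ^ N := by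
    rw [Fintype.card_fun, Fintype.card_fin, Fintype.card_subtype_compl, Fintype.card_fin,
      Fintype.card_subtype_eq]
    simp
  rw [← hcard]
  refine Fintype.card_le_of_injective
    (fun b => fun p => ⟨b.1.2 p, ?_⟩) ?_
  · have hb := b.2
    simp only [ne_eq, ite_eq_right_iff, one_ne_zero, imp_false, not_not] at hb
    exact hb.2 p
  · intro b b' h
    apply Subtype.ext
    have hb := b.2
    have hb' := b'.2
    simp only [ne_eq, ite_eq_right_iff, one_ne_zero, imp_false, not_not] at hb hb'
    refine Prod.ext (hb.1.trans hb'.1.symm) (funext fun p => ?_)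
    have := congr_fun h p
    simpa using congr_arg Subtype.val this

/-- **`⟨n⟩ ⊠ cw_q^{⊠N} ∈ 𝓜_{q^N}`** for `n ≥ 1`. [cite: BlaserIkenmeyerLysikovPandeySchreyer2019, Def. 15] -/
theorem mem_minrankSet_unitKronecker_cwPow {q n N : ℕ} (hn : 0 < n) :
    kroneckerTensor (unitTensor ℂ n) (kroneckerPow (cwTensor ℂ q) N) ∈
      (minrankSet ℂ (q ^ N) : Set (_ → _ → _ → ℂ)) := by
  classical
  refine ⟨fun a => if a = (⟨0, hn⟩, fun _ => (0 : Fin (q + 1))) then 1 else 0, fun h => ?_,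
    rank_contract3_unitKronecker_cwPow_single_le _⟩
  have := congr_fun h (⟨0, hn⟩, fun _ => 0)
  simp at this

/-- `⟨n⟩ ⊠ cw₂^{⊠N} ≠ 0` for `n ≥ 1` (it has a slice of rank `≥ 2^N ≥ 1`). [folklore] -/
theorem unitKronecker_cwTwoPow_ne_zero {n N : ℕ} (hn : 0 < n) :
    kroneckerTensor (unitTensor ℂ n) (kroneckerPow (cwTensor ℂ 2) N) ≠ 0 := by
  classical
  intro h0
  have hx : (fun a : Fin n × (Fin N → Fin 3) => if a = (⟨0, hn⟩, fun _ => (0 : Fin 3)) then (1 : ℂ)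
      else 0) ≠ 0 := by
    intro h
    have := congr_fun h (⟨0, hn⟩, fun _ => 0)
    simp at this
  have h := two_pow_le_rank_contract3_unitKronecker_cwTwoPow (n := n) (N := N) hx
  rw [h0] at h
  have hz : contract3 (0 : (Fin n × (Fin N → Fin 3)) → (Fin n × (Fin N → Fin 3)) →
      (Fin n × (Fin N → Fin 3)) → ℂ)
      (fun a => if a = (⟨0, hn⟩, fun _ => (0 : Fin 3)) then (1 : ℂ) else 0) = 0 := by
    ext b c
    simp [contract3_apply]
  rw [hz, Matrix.rank_zero] at h
  exact absurd h (not_le.mpr (by positivity))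

/-- **`minrank(⟨n⟩ ⊠ cw₂^{⊠N}) = 2^N`** (`n ≥ 1`). [cite: BlaserIkenmeyerLysikovPandeySchreyer2019, Def. 13]
[cite: CoppersmithWinograd1990, §6] -/
theorem minrank_unitKronecker_cwTwoPow {n N : ℕ} (hn : 0 < n) :
    minrank (kroneckerTensor (unitTensor ℂ n) (kroneckerPow (cwTensor ℂ 2) N)) = 2 ^ N := by
  classical
  haveI : Nonempty (Fin n × (Fin N → Fin 3)) := ⟨(⟨0, hn⟩, fun _ => 0)⟩
  apply le_antisymm
  · exact (mem_minrankSet_iff_minrank_le (2 ^ N) _).1 (mem_minrankSet_unitKronecker_cwPow hn)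
  · obtain ⟨x, hx, hr⟩ := (mem_minrankSet_iff_minrank_le
      (minrank (kroneckerTensor (unitTensor ℂ n) (kroneckerPow (cwTensor ℂ 2) N)))
      (kroneckerTensor (unitTensor ℂ n) (kroneckerPow (cwTensor ℂ 2) N))).2 le_rfl
    exact (two_pow_le_rank_contract3_unitKronecker_cwTwoPow hx).trans hr

end CwSide

/-! ## §3  Transport of `𝓜_r` forward along `w ↦ c • (s₁ ⊗ s₂ ⊗ s₃)·w` -/

section Transport

/-- **`𝓜_r` is `ℂˣ × SL³`-stable** (forward direction of BILPS Lemma 18 with scalars): `w₀ ∈ 𝓜_r ⟹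
c • (s₁ ⊗ s₂ ⊗ s₃)·w₀ ∈ 𝓜_r` (`c ≠ 0`; covector `ξ s₁⁻¹`). [cite: BlaserIkenmeyerLysikovPandeySchreyer2019, Lemma 18] -/
theorem smul_actTensor_mem_minrankSet {ι : Type} [Fintype ι] [DecidableEq ι] {r : ℕ} {c : ℂ}
    (hc : c ≠ 0) (s : Matrix.SpecialLinearGroup ι ℂ × Matrix.SpecialLinearGroup ι ℂ ×
      Matrix.SpecialLinearGroup ι ℂ) {w₀ : ι → ι → ι → ℂ}
    (h₀ : w₀ ∈ (minrankSet ℂ r : Set (ι → ι → ι → ℂ))) :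
    c • actTensor (s.1 : Matrix ι ι ℂ) (s.2.1 : Matrix ι ι ℂ) (s.2.2 : Matrix ι ι ℂ) w₀ ∈
      (minrankSet ℂ r : Set (ι → ι → ι → ℂ)) := by
  obtain ⟨ξ, hξ, hrank⟩ := h₀
  have hdet : IsUnit (s.1 : Matrix ι ι ℂ).det := by
    rw [Matrix.SpecialLinearGroup.det_coe]; exact isUnit_one
  set y : ι → ℂ := Matrix.vecMul ξ (s.1 : Matrix ι ι ℂ)⁻¹ with hy
  have hyA : Matrix.vecMul y (s.1 : Matrix ι ι ℂ) = ξ := by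
    rw [hy, Matrix.vecMul_vecMul, Matrix.nonsing_inv_mul _ hdet, Matrix.vecMul_one]
  refine ⟨y, fun hy0 => hξ ?_, ?_⟩
  · rw [← hyA, hy0, Matrix.zero_vecMul]
  · have key : contract3 (c • actTensor (s.1 : Matrix ι ι ℂ) (s.2.1 : Matrix ι ι ℂ)
        (s.2.2 : Matrix ι ι ℂ) w₀) y =
        (c • (s.2.1 : Matrix ι ι ℂ)) * contract3 w₀ ξ * (s.2.2 : Matrix ι ι ℂ)ᵀ := by
      rw [contract3_smul, contract3_actTensor, hyA, ← Matrix.smul_mul, ← Matrix.smul_mul]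
    have h2 : IsUnit (c • (s.2.1 : Matrix ι ι ℂ)).det := by
      rw [Matrix.det_smul, Matrix.SpecialLinearGroup.det_coe, mul_one]
      exact isUnit_iff_ne_zero.mpr (pow_ne_zero _ hc)
    have h3 : IsUnit ((s.2.2 : Matrix ι ι ℂ)ᵀ).det := by
      rw [Matrix.det_transpose, Matrix.SpecialLinearGroup.det_coe]; exact isUnit_one
    rw [key, Matrix.rank_mul_eq_left_of_isUnit_det _ _ h3,
      Matrix.rank_mul_eq_right_of_isUnit_det _ _ h2]
    exact hrank

/-- A restriction from `t` is a restriction from every relabelling `e^* t` of `t`. [folklore] -/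
theorem tensorRestrictsTo_relabel_source {ι ι' κ₁ κ₂ κ₃ : Type*} [Fintype ι] [Fintype ι']
    [Fintype κ₁] [Fintype κ₂] [Fintype κ₃] (e : ι' ≃ ι) {t : ι → ι → ι → ℂ} {s : κ₁ → κ₂ → κ₃ → ℂ}
    (h : TensorRestrictsTo t s) : TensorRestrictsTo (fun a b c => t (e a) (e b) (e c)) s := by
  obtain ⟨A, B, C, hs⟩ := h
  refine ⟨fun x a => A x (e a), fun y b => B y (e b), fun z c => C z (e c), fun x y z => ?_⟩
  rw [hs x y z, ← e.sum_comp]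
  refine Fintype.sum_congr _ _ fun a => ?_
  rw [← e.sum_comp]
  refine Fintype.sum_congr _ _ fun b => ?_
  rw [← e.sum_comp]

end Transport

end Summit.MatrixMultiplication.MatrixMultiplication.Theorems.OutsiderSandwichMinrankExact

end
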